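import Literature.AlgebraicTopology.SingularHomology.IntersectionFormProofs
import Literature.AlgebraicTopology.SingularHomology.PoincareDualityCorollaries
import Literature.AlgebraicTopology.SingularHomology.IntegralClassRingChange
import Literature.AlgebraicTopology.SingularHomology.HomologyRingChange
import Mathlib.RingTheory.Flat.TorsionFree
import HarnessLib

/-!
# A real cohomology class of positive square forces `b⁺ ≥ 1`

A. Hatcher, *Algebraic Topology* (2002), §3.1 p. 198 (change of coefficients `ℤ → ℝ` in
cohomology, compatible with cup products and the Kronecker pairing) with Thm. 3.2 / Cor. 3.3
(universal coefficients) and §3.3 Cor. 3.39 (the cup product pairing modulo torsion of a closed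
oriented manifold is perfect); D. McDuff, D. Salamon, *Introduction to Symplectic Topology*
(3rd ed. 2017), §4.4 and the proof of Thm. 13.3.11: for a closed symplectic four-manifold
"`[ω] ∪ [ω]` is positive on the fundamental class, hence `b⁺ ≥ 1`".  The topological half of that
sentence is PROVED here, for a closed `ℤ`-oriented topological manifold `X` of dimension
`n = k + k` and the intersection form `Q_X` on `Hᵏ(X; ℤ)/T`
(`Literature.AlgebraicTopology.SingularHomology.intersectionForm`):

* `kroneckerPairing_ringChange_coeffChange` — `⟨c ⊗ 1, x ⊗ 1⟩ = ⟨c, x⟩` in a field `K ⊇ ℤ`, on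
  classes (the chain-level `kroneckerPairing_ringChange_eq_cast` of `IntegralClassRingChange`);
* `kroneckerPairing_cupProduct_ringChange` — `⟨(c ⊗ 1) ⌣ (d ⊗ 1), [X] ⊗ 1⟩ = ⟨c ⌣ d, [X]⟩`;
* `linearIndependent_ringChange_of_basis`, `span_ringChange_eq_top` — the images in `Hᵏ(X; ℝ)`
  of lifts of a `ℤ`-basis of `Hᵏ(X; ℤ)/T` form an `ℝ`-basis of `Hᵏ(X; ℝ)` (independence by
  pairing against the dual basis for the perfect form `Q_X`; spanning by the dimension count
  `dim_ℝ Hᵏ(X; ℝ) = b_k(X; ℝ) = b_k(X; ℚ) = rank Hᵏ(X; ℤ)/T`);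
* `exists_int_of_real_quadratic_pos` — a real quadratic form `Σ tᵢ tⱼ Gᵢⱼ` with integer matrix
  that is positive somewhere is positive at an integer vector (density of `ℚ^ι`, clearing
  denominators);
* **`one_le_sigPos_intersectionForm_of_real_sq_pos`** — if some `a ∈ Hᵏ(X; ℝ)` has
  `0 < ⟨a ⌣ a, [X]_ℝ⟩` (`[X]_ℝ` the image of `[X]_μ` under `ℤ → ℝ`), then `1 ≤ b⁺ := sigPos Q_X`.

Everything is proved; no named facts.  Consumer: conjunct (i) of
`Literature.Geometry.Symplectic.taubes_canonicalClass_symplecticCurve_four` /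
`canonicalClass_sq_and_adjunction_of_symplectic_four` (`b⁺ ≥ 1` for the symplectic orientation,
`Literature/Geometry/Symplectic/TaubesCanonicalClassSymplecticCurveFourProofs.lean`).

## References

* A. Hatcher, *Algebraic Topology*, CUP 2002, §3.1 p. 198, Thm. 3.2, Cor. 3.3; §3.3 Cor. 3.39.
  [HatcherAT2002]
* D. McDuff, D. Salamon, *Introduction to Symplectic Topology*, 3rd ed., OUP 2017, §4.4.
  [McDuffSalamon2017]
-/

noncomputable section

open CategoryTheory Set Function Module

namespace Literature.AlgebraicTopology.SingularHomology

open singularChainComplex singularCochainComplex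

/-! ### Change of coefficients `ℤ → K` and the Kronecker / cup pairings -/

section RingChange

variable {X : Type} [TopologicalSpace X] (K : Type) [Field K] [Algebra ℤ K]

/-- The two changes of coefficients `ℤ → K` on singular chains of the tree agree:
`chainCoeffChange (Int.castAddHom K)` (`HomologyRingChange`) and `baseChangeChain ℤ K`
(`IntegralLattice`) are both `∑ rᵢ σᵢ ↦ ∑ (rᵢ : K) σᵢ`. [folklore] -/
theorem chainCoeffChange_intCast_eq_baseChangeChain (m : ℕ) (c : (singularChainComplex ℤ ℤ X).X m) :
    chainCoeffChange (X := X) (Int.castAddHom K) m c = baseChangeChain ℤ K m c := by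
  refine DFunLike.congr_fun (addMonoidHom_ext_single (R₁ := ℤ) (X := X) fun σ r ↦ ?_) c
  rw [chainCoeffChange_single, baseChangeChain_single, Int.coe_castAddHom, eq_intCast]

/-- **`⟨c ⊗ 1, x ⊗ 1⟩ = ⟨c, x⟩`** on classes: the Kronecker pairing of the ring-changed class
`c ⊗ 1 ∈ Hᵐ(X; K)` with the coefficient-changed class `x ⊗ 1 ∈ Hₘ(X; K)` is the image in `K` of
the integral pairing (Hatcher 2002, §3.1 p. 198). [cite: HatcherAT2002, §3.1 p. 198] -/
theorem kroneckerPairing_ringChange_coeffChange {m : ℕ} (c : singularCohomology ℤ ℤ X m)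
    (x : singularHomology ℤ ℤ X m) :
    kroneckerPairing K K X m (singularCohomology.ringChange (algebraMap ℤ K) X m c)
        (singularHomology.coeffChange X (Int.castAddHom K) m x) =
      algebraMap ℤ K (kroneckerPairing ℤ ℤ X m c x) := by
  induction c using singularCohomology_induction_on with
  | h a =>
    induction x using singularHomology_induction_on with
    | h z =>
      rw [singularHomology.coeffChange_homologyπ]
      exact kroneckerPairing_ringChange_eq_cast K a z _ (by
        rw [iCycles_cyclesCoeffChange]
        exact chainCoeffChange_intCast_eq_baseChangeChain K m _)

variable {k n : ℕ}

/-- **`⟨(c ⊗ 1) ⌣ (d ⊗ 1), [X] ⊗ 1⟩ = ⟨c ⌣ d, [X]⟩`**: the real cup pairing of ring-changed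
integral classes against the coefficient-changed fundamental class is the integral cup pairing
(Hatcher 2002, §3.1 p. 198 and §3.2 p. 215: change of rings is multiplicative).
[cite: HatcherAT2002, §3.1 p. 198 and §3.2 p. 215] -/
theorem kroneckerPairing_cupProduct_ringChange (h : k + k = n) (μ : HomologicalOrientation ℤ X n)
    (c d : singularCohomology ℤ ℤ X k) :
    kroneckerPairing K K X n
        (cupProduct h (singularCohomology.ringChange (algebraMap ℤ K) X k c)
          (singularCohomology.ringChange (algebraMap ℤ K) X k d))
        (singularHomology.coeffChange X (Int.castAddHom K) n μ.fundamentalClass) =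
      algebraMap ℤ K (cupPairing μ h c d) := by
  rw [← singularCohomology.ringChange_cupProduct, kroneckerPairing_ringChange_coeffChange,
    cupPairing_apply]

end RingChange

/-! ### Integral classes span real cohomology -/

section Span

variable {X : Type} [TopologicalSpace X] [CompactSpace X] [T2Space X] {k n : ℕ}
  [ChartedSpace (EuclideanSpace ℝ (Fin n)) X]

/-- **Independence.** For a closed `ℤ`-oriented `n`-manifold, `n = k + k`, and a `ℤ`-basis `b` of
`Hᵏ(X; ℤ)/T` with lifts `x̃ⱼ ∈ Hᵏ(X; ℤ)`, the real classes `x̃ⱼ ⊗ 1 ∈ Hᵏ(X; ℝ)` are linearly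
independent over `ℝ`: pair a vanishing combination `Σ tⱼ (x̃ⱼ ⊗ 1)` with `ỹ ⊗ 1` for `y` dual to
`bⱼ₀` under the perfect form `Q_X` (Hatcher 2002, Cor. 3.39) to get `tⱼ₀ = 0`.
[cite: HatcherAT2002, §3.3 Cor. 3.39] -/
theorem linearIndependent_ringChange_of_basis (h : k + k = n) (μ : HomologicalOrientation ℤ X n)
    {ι : Type*} (b : Basis ι ℤ (freeCohomology ℤ X k)) (lift : ι → singularCohomology ℤ ℤ X k)
    (hlift : ∀ j, freeCohomology.mk (lift j) = b j) :
    LinearIndependent ℝ fun j ↦ singularCohomology.ringChange (algebraMap ℤ ℝ) X k (lift j) := by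
  classical
  have hP : (intersectionForm h μ).IsPerfPair :=
    isPerfPair_intersectionForm h μ isPerfPair_cupPairingModTorsion_holds
  rw [linearIndependent_iff']
  intro s g hsum j₀ hj₀
  -- the dual element `y` with `Q_X x y = b.coord j₀ x`
  haveI := hP
  obtain ⟨y, hy⟩ := (LinearMap.IsPerfPair.bijective_right (intersectionForm h μ)).2 (b.coord j₀)
  obtain ⟨ylift, hylift⟩ := freeCohomology.mk_surjective y
  have hQ : ∀ j, intersectionForm h μ (b j) y = if j = j₀ then 1 else 0 := by
    intro j
    have e := LinearMap.congr_fun hy (b j)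
    rw [LinearMap.flip_apply] at e
    rw [e, Basis.coord_apply, Basis.repr_self, Finsupp.single_apply]
  -- pair the relation with `ylift ⊗ 1`
  set FX := singularHomology.coeffChange X (Int.castAddHom ℝ) n μ.fundamentalClass with hFX
  have key := congrArg (fun a ↦ kroneckerPairing ℝ ℝ X n
    (cupProduct h a (singularCohomology.ringChange (algebraMap ℤ ℝ) X k ylift)) FX) hsum
  simp only [map_sum, map_smul, LinearMap.sum_apply, LinearMap.smul_apply, map_zero,
    LinearMap.zero_apply, smul_eq_mul] at key
  have hterm : ∀ j, kroneckerPairing ℝ ℝ X n (cupProduct h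
      (singularCohomology.ringChange (algebraMap ℤ ℝ) X k (lift j))
      (singularCohomology.ringChange (algebraMap ℤ ℝ) X k ylift)) FX = if j = j₀ then 1 else 0 := by
    intro j
    rw [hFX, kroneckerPairing_cupProduct_ringChange ℝ h μ, ← intersectionForm_mk_mk, hlift, hylift,
      hQ j]
    split_ifs <;> simp
  simp only [hterm, mul_ite, mul_one, mul_zero, Finset.sum_ite_eq', if_pos hj₀] at key
  exact key

/-- **Spanning.** With the notation of `linearIndependent_ringChange_of_basis`, for a finite basis
the classes `x̃ⱼ ⊗ 1` span `Hᵏ(X; ℝ)` over `ℝ`: they are independent and their number is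
`rank Hᵏ(X; ℤ)/T = b_k(X; ℚ) = b_k(X; ℝ) = dim_ℝ Hᵏ(X; ℝ)` (Hatcher 2002, Thm. 3.2 / Cor. 3.3;
the tree's `finrank_freeCohomology_eq_bettiNumber_holds`, `bettiNumber_rat_eq_real`,
`finrank_singularCohomology_eq_bettiNumber_of_field`). [cite: HatcherAT2002, §3.1 Thm. 3.2 and Cor. 3.3] -/
theorem span_ringChange_eq_top (h : k + k = n) (μ : HomologicalOrientation ℤ X n)
    {ι : Type*} [Fintype ι] (b : Basis ι ℤ (freeCohomology ℤ X k))
    (lift : ι → singularCohomology ℤ ℤ X k) (hlift : ∀ j, freeCohomology.mk (lift j) = b j) :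
    Submodule.span ℝ (Set.range fun j ↦ singularCohomology.ringChange (algebraMap ℤ ℝ) X k (lift j)) =
      ⊤ := by
  have hF : finite_singularCohomology_of_compactSpace ℤ X n k :=
    finite_singularCohomology_of_compactSpace_of_isPrincipalIdealRing ℤ X n k
  haveI : Module.Finite ℤ (freeCohomology ℤ X k) := finite_freeCohomology hF
  haveI : Module.Finite ℝ (singularCohomology ℝ ℝ X k) :=
    finite_singularCohomology_of_compactSpace_of_isPrincipalIdealRing ℝ X n k
  refine (linearIndependent_ringChange_of_basis h μ b lift hlift).span_eq_top_of_card_eq_finrank' ?_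
  rw [← Module.finrank_eq_card_basis b, finrank_freeCohomology_eq_bettiNumber_holds (n := n) k,
    bettiNumber_rat_eq_real, finrank_singularCohomology_eq_bettiNumber_of_field]

end Span

/-! ### A real quadratic form with integer matrix, positive somewhere, is positive at an integer vector -/

section Arithmetic

/-- **Expanding a bilinear map on two finite combinations**:
`B (Σ cᵢ vᵢ) (Σ dⱼ vⱼ) = Σᵢ Σⱼ cᵢ dⱼ B(vᵢ, vⱼ)`. [folklore] -/
theorem bilin_apply_sum_smul_sum_smul {R M : Type*} [CommSemiring R] [AddCommMonoid M] [Module R M]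
    {ι : Type*} [Fintype ι] (B : M →ₗ[R] M →ₗ[R] R) (v : ι → M) (c d : ι → R) :
    B (∑ i, c i • v i) (∑ j, d j • v j) = ∑ i, ∑ j, c i * d j * B (v i) (v j) := by
  calc B (∑ i, c i • v i) (∑ j, d j • v j)
      = ∑ j, d j * B (∑ i, c i • v i) (v j) := by
        rw [map_sum]
        exact Finset.sum_congr rfl fun j _ ↦ by rw [map_smul, smul_eq_mul]
    _ = ∑ j, d j * ∑ i, c i * B (v i) (v j) := by
        refine Finset.sum_congr rfl fun j _ ↦ ?_
        rw [map_sum, LinearMap.sum_apply]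
        congr 1
        exact Finset.sum_congr rfl fun i _ ↦ by rw [map_smul, LinearMap.smul_apply, smul_eq_mul]
    _ = ∑ i, ∑ j, c i * d j * B (v i) (v j) := by
        simp_rw [Finset.mul_sum]
        rw [Finset.sum_comm]
        exact Finset.sum_congr rfl fun i _ ↦ Finset.sum_congr rfl fun j _ ↦ by ring

/-- **Clearing denominators**: for a finite family of rationals there is a positive integer `D`
and integers `mᵢ` with `qᵢ · D = mᵢ`. [folklore] -/
theorem exists_int_mul_eq_of_rat {ι : Type*} [Fintype ι] (q : ι → ℚ) :
    ∃ (D : ℕ) (m : ι → ℤ), 0 < D ∧ ∀ i, q i * D = m i := by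
  classical
  set D : ℕ := ∏ i, (q i).den with hD
  have hDpos : 0 < D := Finset.prod_pos fun i _ ↦ (q i).den_pos
  have hdvd : ∀ i, (q i).den ∣ D := fun i ↦ Finset.dvd_prod_of_mem _ (Finset.mem_univ i)
  refine ⟨D, fun i ↦ (q i).num * ((D / (q i).den : ℕ) : ℤ), hDpos, fun i ↦ ?_⟩
  obtain ⟨e, he⟩ := hdvd i
  have hq : D / (q i).den = e := by rw [he, Nat.mul_div_cancel_left e (q i).den_pos]
  show q i * (D : ℚ) = (((q i).num * ((D / (q i).den : ℕ) : ℤ) : ℤ) : ℚ)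
  rw [hq, he]
  push_cast
  rw [← mul_assoc, Rat.mul_den_eq_num]

/-- **A real quadratic form with integer Gram matrix that is positive at some real vector is
positive at some integer vector**: `t ↦ Σᵢⱼ tᵢ tⱼ Gᵢⱼ` is continuous, so it is positive on an
open set, which contains a rational vector (density of `ℚ^ι` in `ℝ^ι`); clearing denominators
multiplies the value by a positive square. [folklore] -/
theorem exists_int_of_real_quadratic_pos {ι : Type*} [Fintype ι] (G : ι → ι → ℤ) (t : ι → ℝ)
    (ht : 0 < ∑ i, ∑ j, t i * t j * G i j) :
    ∃ m : ι → ℤ, 0 < ∑ i, ∑ j, m i * m j * G i j := by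
  classical
  -- the open positivity set contains a rational point
  have hcont : Continuous fun s : ι → ℝ ↦ ∑ i, ∑ j, s i * s j * G i j := by fun_prop
  have hopen : IsOpen {s : ι → ℝ | 0 < ∑ i, ∑ j, s i * s j * G i j} :=
    isOpen_lt continuous_const hcont
  have hdense : DenseRange (Pi.map fun (_ : ι) (r : ℚ) ↦ (r : ℝ)) :=
    DenseRange.piMap fun _ ↦ Rat.isDenseEmbedding_coe_real.dense
  obtain ⟨q, hq⟩ := hdense.exists_mem_open hopen ⟨t, ht⟩
  simp only [Set.mem_setOf_eq, Pi.map_apply] at hq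
  -- clear denominators
  obtain ⟨D, m, hD, hm⟩ := exists_int_mul_eq_of_rat q
  refine ⟨m, ?_⟩
  have hq' : (0 : ℚ) < ∑ i, ∑ j, q i * q j * G i j := by
    have : ((∑ i, ∑ j, q i * q j * G i j : ℚ) : ℝ) = ∑ i, ∑ j, (q i : ℝ) * q j * G i j := by
      push_cast
      rfl
    exact_mod_cast (this ▸ hq : (0 : ℝ) < ((∑ i, ∑ j, q i * q j * G i j : ℚ) : ℝ))
  have hscale : (∑ i, ∑ j, (m i : ℚ) * m j * G i j) = (D : ℚ) ^ 2 * ∑ i, ∑ j, q i * q j * G i j := by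
    rw [Finset.mul_sum]
    refine Finset.sum_congr rfl fun i _ ↦ ?_
    rw [Finset.mul_sum]
    refine Finset.sum_congr rfl fun j _ ↦ ?_
    rw [← hm i, ← hm j]
    ring
  have : (0 : ℚ) < ∑ i, ∑ j, (m i : ℚ) * m j * G i j := by
    rw [hscale]
    exact mul_pos (pow_pos (Nat.cast_pos.2 hD) 2) hq'
  exact_mod_cast this

end Arithmetic

/-! ### The theorem -/

section Main

variable {X : Type} [TopologicalSpace X] [CompactSpace X] [T2Space X] {k n : ℕ}
  [ChartedSpace (EuclideanSpace ℝ (Fin n)) X]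

/-- **A vector of positive square gives `sigPos ≥ 1`** (any ordered coefficient ring, any finite
torsion-free module): if `Q(z, z) > 0` then the line `R z` is a positive definite submodule of rank
one, so `1 ≤ sigPos Q`. [folklore] -/
theorem one_le_sigPos_of_apply_self_pos {R M : Type*} [CommRing R] [LinearOrder R]
    [IsStrictOrderedRing R] [NoZeroDivisors R] [AddCommGroup M] [Module R M] [Module.Finite R M]
    [Module.IsTorsionFree R M] (Q : LinearMap.BilinForm R M) (z : M) (hz : 0 < Q z z) :
    1 ≤ sigPos Q.toQuadraticMap := by
  have hz0 : z ≠ 0 := by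
    rintro rfl
    simp at hz
  have key := le_sigPos_of_posDef (Q := Q.toQuadraticMap) (V := R ∙ z) (fun w hw ↦ by
    obtain ⟨c, hc⟩ := Submodule.mem_span_singleton.1 w.2
    have hc0 : c ≠ 0 := by
      rintro rfl
      rw [zero_smul] at hc
      exact hw (Subtype.ext hc.symm)
    rw [QuadraticMap.restrict_apply, LinearMap.BilinMap.toQuadraticMap_apply, ← hc, map_smul,
      map_smul, LinearMap.smul_apply, smul_eq_mul, smul_eq_mul, ← mul_assoc]
    exact mul_pos (mul_self_pos.2 hc0) hz)
  refine le_trans (le_of_eq ?_) key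
  rw [← (LinearEquiv.toSpanNonzeroSingleton R M z hz0).finrank_eq, Module.finrank_self]

/-- **An integral class of positive square gives `b⁺ ≥ 1`**: if `z ∈ Hᵏ(X; ℤ)/T` has `Q_X(z, z) > 0`
then `1 ≤ sigPos Q_X` (the line `ℤ z` is a positive definite sublattice of rank one of the finite
free `ℤ`-module `Hᵏ(X; ℤ)/T`). [cite: HatcherAT2002, §3.3 Cor. 3.39] -/
theorem one_le_sigPos_intersectionForm_of_sq_pos (h : k + k = n) (μ : HomologicalOrientation ℤ X n)
    (z : freeCohomology ℤ X k) (hz : 0 < intersectionForm h μ z z) :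
    1 ≤ sigPos (intersectionForm h μ).toQuadraticMap := by
  have hF : finite_singularCohomology_of_compactSpace ℤ X n k :=
    finite_singularCohomology_of_compactSpace_of_isPrincipalIdealRing ℤ X n k
  haveI : Module.Finite ℤ (freeCohomology ℤ X k) := finite_freeCohomology hF
  haveI : Module.Free ℤ (freeCohomology ℤ X k) := free_freeCohomology hF
  -- free ⇒ flat ⇒ torsion-free
  haveI : Module.IsTorsionFree ℤ (freeCohomology ℤ X k) := inferInstance
  exact one_le_sigPos_of_apply_self_pos (intersectionForm h μ) z hz

/-- **A real class of positive square forces `b⁺ ≥ 1`** (McDuff–Salamon 2017, §4.4 / proof of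
Thm. 13.3.11: "`[ω] ∪ [ω] > 0`, hence `b⁺ ≥ 1`"; Hatcher 2002, §3.1 p. 198, Thm. 3.2, Cor. 3.3,
§3.3 Cor. 3.39): let `X` be a closed `ℤ`-oriented topological `n`-manifold, `n = k + k`, and let
`a ∈ Hᵏ(X; ℝ)` satisfy `0 < ⟨a ⌣ a, [X]_ℝ⟩`, where `[X]_ℝ ∈ Hₙ(X; ℝ)` is the image of the
fundamental class `[X]_μ` under `ℤ → ℝ`.  Then the intersection form `Q_X` on `Hᵏ(X; ℤ)/T` has a
positive definite sublattice of rank one, `1 ≤ b⁺ = sigPos Q_X`.  Proof: `a` is a real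
combination `Σ tⱼ (x̃ⱼ ⊗ 1)` of lifts of a `ℤ`-basis of `Hᵏ(X; ℤ)/T` (`span_ringChange_eq_top`),
so `0 < ⟨a ⌣ a, [X]_ℝ⟩ = Σ tᵢ tⱼ Q_X(xᵢ, xⱼ)`; by `exists_int_of_real_quadratic_pos` some integer
vector `m` has `0 < Σ mᵢ mⱼ Q_X(xᵢ, xⱼ) = Q_X(z, z)`, `z = Σ mⱼ xⱼ`.
[cite: McDuffSalamon2017, §4.4] [cite: HatcherAT2002, §3.1 p. 198, Thm. 3.2; §3.3 Cor. 3.39] -/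
theorem one_le_sigPos_intersectionForm_of_real_sq_pos (h : k + k = n)
    (μ : HomologicalOrientation ℤ X n) (a : singularCohomology ℝ ℝ X k)
    (ha : 0 < kroneckerPairing ℝ ℝ X n (cupProduct h a a)
      (singularHomology.coeffChange X (Int.castAddHom ℝ) n μ.fundamentalClass)) :
    1 ≤ sigPos (intersectionForm h μ).toQuadraticMap := by
  classical
  have hF : finite_singularCohomology_of_compactSpace ℤ X n k :=
    finite_singularCohomology_of_compactSpace_of_isPrincipalIdealRing ℤ X n k
  haveI : Module.Finite ℤ (freeCohomology ℤ X k) := finite_freeCohomology hF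
  haveI : Module.Free ℤ (freeCohomology ℤ X k) := free_freeCohomology hF
  -- a `ℤ`-basis of `Hᵏ(X; ℤ)/T` and lifts
  set b := Module.Free.chooseBasis ℤ (freeCohomology ℤ X k) with hb
  let lift : Module.Free.ChooseBasisIndex ℤ (freeCohomology ℤ X k) → singularCohomology ℤ ℤ X k :=
    fun j ↦ Classical.choose (freeCohomology.mk_surjective (b j))
  have hlift : ∀ j, freeCohomology.mk (lift j) = b j := fun j ↦
    Classical.choose_spec (freeCohomology.mk_surjective (b j))
  -- write `a` in this basis
  have hmem : a ∈ Submodule.span ℝ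
      (Set.range fun j ↦ singularCohomology.ringChange (algebraMap ℤ ℝ) X k (lift j)) := by
    rw [span_ringChange_eq_top h μ b lift hlift]
    exact Submodule.mem_top
  obtain ⟨t, rfl⟩ := (Submodule.mem_span_range_iff_exists_fun ℝ).1 hmem
  -- the real pairing as a bilinear map and its values on the lifts
  set FX := singularHomology.coeffChange X (Int.castAddHom ℝ) n μ.fundamentalClass with hFX
  set Bℝ : singularCohomology ℝ ℝ X k →ₗ[ℝ] singularCohomology ℝ ℝ X k →ₗ[ℝ] ℝ :=
    (cupProduct h).compr₂ ((kroneckerPairing ℝ ℝ X n).flip FX) with hBℝ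
  have hBapply : ∀ x y, Bℝ x y = kroneckerPairing ℝ ℝ X n (cupProduct h x y) FX := fun x y ↦ by
    rw [hBℝ, LinearMap.compr₂_apply, LinearMap.flip_apply]
  have hBlift : ∀ i j, Bℝ (singularCohomology.ringChange (algebraMap ℤ ℝ) X k (lift i))
      (singularCohomology.ringChange (algebraMap ℤ ℝ) X k (lift j)) =
      (intersectionForm h μ (b i) (b j) : ℝ) := fun i j ↦ by
    rw [hBapply, hFX, kroneckerPairing_cupProduct_ringChange ℝ h μ, ← intersectionForm_mk_mk, hlift,
      hlift, eq_intCast]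
  -- expand `⟨a ⌣ a, [X]_ℝ⟩ = Σ tᵢ tⱼ Q(bᵢ, bⱼ)`
  have ha' : 0 < ∑ i, ∑ j, t i * t j * (intersectionForm h μ (b i) (b j) : ℝ) := by
    rw [← hBapply, bilin_apply_sum_smul_sum_smul] at ha
    simpa only [hBlift] using ha
  -- an integer vector of positive square
  obtain ⟨m, hm⟩ := exists_int_of_real_quadratic_pos (fun i j ↦ intersectionForm h μ (b i) (b j)) t ha'
  refine one_le_sigPos_intersectionForm_of_sq_pos h μ (b.equivFun.symm m) ?_
  rw [Basis.equivFun_symm_apply, bilin_apply_sum_smul_sum_smul]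
  exact hm

end Main

end Literature.AlgebraicTopology.SingularHomology

end
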